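import Summits.AnomalousDissipation.AnomalousDissipation.Statement
import Summits.AnomalousDissipation.AnomalousDissipation.Theorems.SoloInformedLiouvilleModes
import Literature.Analysis.FluidPDE.TwoHalfNavierStokes
import Literature.Analysis.FluidPDE.TorusClassicalLerayHopfProofs
import Literature.Analysis.FluidPDE.PassiveScalarClassicalEnergy
import Literature.Analysis.FluidPDE.GalerkinEnergyBalanceLongTime
import HarnessLib

/-!
# Drift states I: the general `2½`-dimensional constant-drift laminar class (solo-informed)

The Liouville laminar states of `SoloInformedLiouvilleStates` are one member of a CLASS of exact
steady Navier–Stokes states under a `ν`-independent smooth force, parametrised by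

* a constant planar drift `c ∈ ℝ²`,
* frequencies `k_n ∈ ℤ² \ {0}` (`n ∈ ℕ`) and complex force amplitudes `w_n` of rapid
  decay (`∑_n |w_n| (2π(1+|k_n|²))^m < ∞` for every `m`, i.e.
  `h = ∑_n M_{k_n}(w_n) ∈ C^∞(T²)`),
* the NON-RESONANCE condition `σ_n = 2π c·k_n ≠ 0` for every `n`.

With `λ_n = 4π²|k_n|²` and `z_n(ν) = w_n/(iσ_n + νλ_n)` the planar scalar
`R_ν = ∑_n M_{k_n}(z_n(ν))` solves the steady drift–diffusion equation `c·∇R_ν - νΔR_ν = h`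
(`drift_diffusion_RD`), and `U_ν = (c, R_ν) ∘ π` is, for every `ν > 0`, an exact smooth steady
solution of `NS_ν` on `T³` with the force `f = (0, h) ∘ π` and zero pressure
(`isClassicalNSSolutionOn_UD`; `Torus.isClassicalNSSolutionOn_twoHalf`).  If moreover
`A = ∑_n |w_n|/|σ_n| < ∞` then `|R_ν| ≤ A` pointwise for every `ν`, so the energy is bounded
uniformly in `ν`: `∫‖U_ν‖² ≤ |c|² + A²` (`integral_norm_sq_UD_le`).  The companion file
`SoloInformedDriftRateCeiling` proves that in this whole class the dissipation obeys
`ν‖∇U_ν‖₂² ≤ C_θ ν^θ` for every `θ < 1`: no member of the class is a witness of the zeroth law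
`AnomalousDissipation`, however the drift direction and the force profile are chosen.

References: A. Cheskidov, arXiv:2311.04182 §3, §6 and E. Bruè, C. De Lellis, CMP 400 (2023) §3
(the `2½`-dimensional ansatz) [Cheskidov2023, BrueDeLellis2023]; L. Grafakos, *Classical Fourier
Analysis* (2014) Prop. 3.2.6–3.3.12 [Grafakos2014].
-/

noncomputable section

open MeasureTheory Filter Topology Set UnitAddTorus
open scoped ENNReal NNReal InnerProductSpace Real ComplexConjugate

namespace Summit.AnomalousDissipation.AnomalousDissipation.Theorems

open Literature.Analysis.FunctionSpaces Literature.Analysis.FunctionSpaces.Torus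
  Literature.Analysis.FluidPDE

/-! ## Symbols and response coefficients -/

section Coefficients

variable (c : EuclideanSpace ℝ (Fin 2)) (k : ℕ → Fin 2 → ℤ) (w : ℕ → ℂ)

/-- Drift symbol `σ_n = 2π c·k_n`. [folklore] -/
def σD (n : ℕ) : ℝ := 2 * Real.pi * ∑ j, c j * (k n j : ℝ)

/-- Laplacian symbol `λ_n = 4π² |k_n|²`. [folklore] -/
def lamD (n : ℕ) : ℝ := 4 * Real.pi ^ 2 * freqNormSq (k n)

/-- The symbol `iσ_n + νλ_n` of `c·∇ - νΔ` on the mode `k_n`. [folklore] -/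
def denD (ν : ℝ) (n : ℕ) : ℂ := (σD c k n : ℂ) * Complex.I + ((ν * lamD k n : ℝ) : ℂ)

/-- Response coefficients `z_n(ν) = w_n / (iσ_n + νλ_n)`. [folklore] -/
def zD (ν : ℝ) (n : ℕ) : ℂ := w n / denD c k ν n

variable {c k w}

/-- `1 ≤ |K|²` for a non-zero integer frequency. [folklore] -/
theorem one_le_freqNormSq_of_ne {d : Type*} [Fintype d] {K : d → ℤ} (hK : K ≠ 0) :
    1 ≤ freqNormSq K := by
  obtain ⟨i, hi⟩ : ∃ i, K i ≠ 0 := Function.ne_iff.1 hK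
  have h1 : (1 : ℝ) ≤ (K i : ℝ) ^ 2 := by
    have h : (1 : ℤ) ≤ K i ^ 2 := by nlinarith [Int.one_le_abs hi, sq_abs (K i)]
    exact_mod_cast h
  exact h1.trans (Finset.single_le_sum (f := fun j => (K j : ℝ) ^ 2) (fun j _ => sq_nonneg _)
    (Finset.mem_univ i))

/-- `λ_n ≥ 0`. [folklore] -/
theorem lamD_nonneg (n : ℕ) : 0 ≤ lamD k n := by
  have := freqNormSq_nonneg (k n); unfold lamD; positivity

/-- `λ_n ≥ 1` when `k_n ≠ 0`. [folklore] -/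
theorem one_le_lamD {n : ℕ} (hk : k n ≠ 0) : 1 ≤ lamD k n := by
  have h1 := one_le_freqNormSq_of_ne hk
  have h2 : (1 : ℝ) ≤ 4 * Real.pi ^ 2 := by nlinarith [Real.two_le_pi]
  unfold lamD; nlinarith

/-- `λ_n ≤ (2π(1+|k_n|²))²` (the rapid-decay weight dominates the Laplacian symbol). [folklore] -/
theorem lamD_le_weight_sq (n : ℕ) : lamD k n ≤ (2 * Real.pi * (1 + freqNormSq (k n))) ^ 2 := by
  have hF := freqNormSq_nonneg (k n)
  unfold lamD
  nlinarith [mul_pos Real.pi_pos Real.pi_pos, sq_nonneg (freqNormSq (k n)),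
    mul_nonneg (mul_pos Real.pi_pos Real.pi_pos).le hF]

/-- `Im (iσ_n + νλ_n) = σ_n`. [folklore] -/
theorem denD_im (ν : ℝ) (n : ℕ) : (denD c k ν n).im = σD c k n := by simp [denD, Complex.mul_im]

/-- `Re (iσ_n + νλ_n) = νλ_n`. [folklore] -/
theorem denD_re (ν : ℝ) (n : ℕ) : (denD c k ν n).re = ν * lamD k n := by simp [denD, Complex.mul_re]

/-- `|iσ_n + νλ_n|² = σ_n² + ν²λ_n²`. [folklore] -/
theorem norm_sq_denD (ν : ℝ) (n : ℕ) : ‖denD c k ν n‖ ^ 2 = σD c k n ^ 2 + (ν * lamD k n) ^ 2 := by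
  rw [Complex.sq_norm, Complex.normSq_apply, denD_re, denD_im]; ring

/-- Non-resonance: `iσ_n + νλ_n ≠ 0` for every real `ν` as soon as `σ_n ≠ 0`. [folklore] -/
theorem denD_ne_zero {n : ℕ} (hσ : σD c k n ≠ 0) (ν : ℝ) : denD c k ν n ≠ 0 := by
  intro h
  have := denD_im (c := c) (k := k) ν n
  rw [h, Complex.zero_im] at this
  exact hσ this.symm

/-- `|σ_n| ≤ |iσ_n + νλ_n|`. [folklore] -/
theorem abs_σD_le_norm_denD (ν : ℝ) (n : ℕ) : |σD c k n| ≤ ‖denD c k ν n‖ := by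
  rw [← denD_im (c := c) (k := k) ν n]; exact Complex.abs_im_le_norm _

/-- `νλ_n ≤ |iσ_n + νλ_n|`. [folklore] -/
theorem mul_lamD_le_norm_denD (ν : ℝ) (n : ℕ) : ν * lamD k n ≤ ‖denD c k ν n‖ := by
  rw [← denD_re (c := c) (k := k) ν n]; exact Complex.re_le_norm _

/-- The response solves the mode equation `(iσ_n + νλ_n) z_n(ν) = w_n`. [folklore] -/
theorem denD_mul_zD {n : ℕ} (hσ : σD c k n ≠ 0) (ν : ℝ) : denD c k ν n * zD c k w ν n = w n := by
  rw [zD, mul_div_cancel₀ _ (denD_ne_zero hσ ν)]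

/-- **Uniform bound** `|z_n(ν)| ≤ |w_n|/|σ_n|` for EVERY real `ν`. [folklore] -/
theorem norm_zD_le {n : ℕ} (hσ : σD c k n ≠ 0) (ν : ℝ) :
    ‖zD c k w ν n‖ ≤ ‖w n‖ / |σD c k n| := by
  rw [zD, norm_div]
  exact div_le_div_of_nonneg_left (norm_nonneg _) (abs_pos.2 hσ) (abs_σD_le_norm_denD ν n)

/-- For `ν > 0`: `|z_n(ν)| ≤ |w_n|/(νλ_n) ≤ |w_n|/ν`. [folklore] -/
theorem norm_zD_le_of_pos {ν : ℝ} (hν : 0 < ν) {n : ℕ} (hk : k n ≠ 0) :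
    ‖zD c k w ν n‖ ≤ ‖w n‖ / ν := by
  rw [zD, norm_div]
  have h1 : ν ≤ ‖denD c k ν n‖ := by
    refine le_trans ?_ (mul_lamD_le_norm_denD ν n)
    have := one_le_lamD hk; nlinarith
  exact div_le_div_of_nonneg_left (norm_nonneg _) hν h1

/-- `|z_n(ν)|² = |w_n|²/(σ_n² + ν²λ_n²)`. [folklore] -/
theorem norm_sq_zD (ν : ℝ) (n : ℕ) :
    ‖zD c k w ν n‖ ^ 2 = ‖w n‖ ^ 2 / (σD c k n ^ 2 + (ν * lamD k n) ^ 2) := by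
  rw [zD, norm_div, div_pow, norm_sq_denD]

/-- The weights `(2π(1+|k_n|²))^m` are non-negative. [folklore] -/
theorem weightD_pow_nonneg (n m : ℕ) : 0 ≤ (2 * Real.pi * (1 + freqNormSq (k n))) ^ m :=
  pow_nonneg (by have := freqNormSq_nonneg (k n); positivity) m

/-- The response coefficients decay rapidly for every `ν > 0` (`|z_n| ≤ |w_n|/ν`).
[cite: Grafakos2014, Prop. 3.3.12] -/
theorem rapidDecay_zD {ν : ℝ} (hν : 0 < ν) (hk : ∀ n, k n ≠ 0) (hw : RapidDecay k w) :
    RapidDecay k (zD c k w ν) := by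
  intro m
  refine Summable.of_nonneg_of_le (fun n => mul_nonneg (norm_nonneg _) (weightD_pow_nonneg n m))
    (fun n => ?_) ((hw m).mul_left ν⁻¹)
  rw [← mul_assoc]
  refine mul_le_mul_of_nonneg_right ?_ (weightD_pow_nonneg n m)
  rw [inv_mul_eq_div]
  exact norm_zD_le_of_pos hν (hk n)

/-- Under `A = ∑_n |w_n|/|σ_n| < ∞`: `∑_n |z_n(ν)| < ∞` for every `ν`. [folklore] -/
theorem summable_norm_zD (hσ : ∀ n, σD c k n ≠ 0) (hA : Summable fun n => ‖w n‖ / |σD c k n|)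
    (ν : ℝ) : Summable fun n => ‖zD c k w ν n‖ :=
  Summable.of_nonneg_of_le (fun _ => norm_nonneg _) (fun n => norm_zD_le (hσ n) ν) hA

/-- Under `A < ∞`: `∑_n |z_n(ν)| ≤ A` for every `ν`. [folklore] -/
theorem tsum_norm_zD_le (hσ : ∀ n, σD c k n ≠ 0) (hA : Summable fun n => ‖w n‖ / |σD c k n|)
    (ν : ℝ) : ∑' n, ‖zD c k w ν n‖ ≤ ∑' n, ‖w n‖ / |σD c k n| :=
  (summable_norm_zD hσ hA ν).tsum_le_tsum (fun n => norm_zD_le (hσ n) ν) hA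

end Coefficients

/-! ## The planar force profile and the laminar response -/

section Planar

variable (c : EuclideanSpace ℝ (Fin 2)) (k : ℕ → Fin 2 → ℤ) (w : ℕ → ℂ)

/-- The planar force profile `h = ∑_n M_{k_n}(w_n)`. [folklore] -/
def hD : UnitAddTorus (Fin 2) → ℝ := modeSeries k w

/-- The laminar response `R_ν = ∑_n M_{k_n}(z_n(ν))`. [folklore] -/
def RD (ν : ℝ) : UnitAddTorus (Fin 2) → ℝ := modeSeries k (zD c k w ν)

variable {c k w}

/-- `h` is smooth. [folklore] -/
theorem isSmooth_hD (hw : RapidDecay k w) : IsSmooth (hD k w) := hw.isSmooth_modeSeries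

/-- `h` has zero mean. [folklore] -/
theorem hasZeroMean_hD (hk : ∀ n, k n ≠ 0) (hw : RapidDecay k w) : HasZeroMean (hD k w) :=
  hasZeroMean_modeSeries hw.summable_norm hk

/-- `R_ν` is smooth (`ν > 0`). [folklore] -/
theorem isSmooth_RD {ν : ℝ} (hν : 0 < ν) (hk : ∀ n, k n ≠ 0) (hw : RapidDecay k w) :
    IsSmooth (RD c k w ν) :=
  (rapidDecay_zD hν hk hw).isSmooth_modeSeries

/-- **Uniform pointwise bound** `|R_ν| ≤ A = ∑_n |w_n|/|σ_n|` (all `ν`). [folklore] -/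
theorem abs_RD_le (hσ : ∀ n, σD c k n ≠ 0) (hA : Summable fun n => ‖w n‖ / |σD c k n|) (ν : ℝ)
    (y : UnitAddTorus (Fin 2)) : |RD c k w ν y| ≤ ∑' n, ‖w n‖ / |σD c k n| :=
  (abs_modeSeries_le (summable_norm_zD hσ hA ν) y).trans (tsum_norm_zD_le hσ hA ν)

/-- **The steady drift–diffusion equation** `c·∇R_ν - νΔR_ν = h` (termwise: the symbol of
`c·∇ - νΔ` on `M_{k_n}` is `iσ_n + νλ_n`, and `(iσ_n + νλ_n) z_n(ν) = w_n`). [folklore] -/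
theorem drift_diffusion_RD {ν : ℝ} (hν : 0 < ν) (hk : ∀ n, k n ≠ 0) (hw : RapidDecay k w)
    (hσ : ∀ n, σD c k n ≠ 0) (y : UnitAddTorus (Fin 2)) :
    ⟪c, gradient (RD c k w ν) y⟫_ℝ - ν * laplacian (RD c k w ν) y = hD k w y := by
  have hz := rapidDecay_zD (c := c) hν hk hw
  have hR1 : IsContDiff 1 (RD c k w ν) := (isSmooth_RD hν hk hw).isContDiff (by simp)
  have hsum1 : ∀ j : Fin 2, Summable fun n =>
      rmode (k n) (2 * Real.pi * Complex.I * (k n j) * zD c k w ν n) y := fun j =>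
    ((hz.summableLiftBounds.partialDeriv j).summable_apply y).congr
      fun n => partialDeriv_rmode _ _ _ _
  have hsum2 : Summable fun n =>
      -(4 * Real.pi ^ 2 * freqNormSq (k n)) * rmode (k n) (zD c k w ν n) y := by
    refine Summable.of_norm_bounded ((hz 1).mul_left (2 * Real.pi)) fun n => ?_
    have hF := freqNormSq_nonneg (k n)
    rw [norm_mul, norm_neg, Real.norm_eq_abs, abs_of_nonneg (by positivity), pow_one]
    calc 4 * Real.pi ^ 2 * freqNormSq (k n) * ‖rmode (k n) (zD c k w ν n) y‖
        ≤ 4 * Real.pi ^ 2 * freqNormSq (k n) * ‖zD c k w ν n‖ :=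
          mul_le_mul_of_nonneg_left (norm_rmode_le _ _ _) (by positivity)
      _ ≤ 2 * Real.pi * (‖zD c k w ν n‖ * (2 * Real.pi * (1 + freqNormSq (k n)))) := by
          nlinarith [norm_nonneg (zD c k w ν n), Real.pi_pos,
            mul_nonneg (norm_nonneg (zD c k w ν n)) hF]
  rw [inner_gradient_eq_sum_mul_partialDeriv hR1]
  have hd : ∀ j, partialDeriv j (RD c k w ν) y =
      ∑' n, rmode (k n) (2 * Real.pi * Complex.I * (k n j) * zD c k w ν n) y :=
    fun j => hz.partialDeriv_modeSeries j y
  have hl : laplacian (RD c k w ν) y =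
      ∑' n, -(4 * Real.pi ^ 2 * freqNormSq (k n)) * rmode (k n) (zD c k w ν n) y :=
    hz.laplacian_modeSeries y
  simp_rw [hd]
  rw [hl]
  have h1 : ∑ j, c j * ∑' n, rmode (k n) (2 * Real.pi * Complex.I * (k n j) * zD c k w ν n) y
      = ∑' n, ∑ j, c j * rmode (k n) (2 * Real.pi * Complex.I * (k n j) * zD c k w ν n) y := by
    rw [Summable.tsum_finsetSum (fun j _ => (hsum1 j).mul_left (c j))]
    simp_rw [tsum_mul_left]
  have h2 : ∀ n, ∑ j, c j * rmode (k n) (2 * Real.pi * Complex.I * (k n j) * zD c k w ν n) y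
      = rmode (k n) ((σD c k n : ℂ) * Complex.I * zD c k w ν n) y := by
    intro n
    simp_rw [← rmode_ofReal_mul]
    rw [← rmode_sum]
    congr 1
    calc ∑ j, (c j : ℂ) * (2 * Real.pi * Complex.I * (k n j) * zD c k w ν n)
        = (((∑ j, c j * (k n j : ℝ)) : ℝ) : ℂ) * (2 * Real.pi * Complex.I * zD c k w ν n) := by
          push_cast
          rw [Finset.sum_mul]
          exact Finset.sum_congr rfl fun j _ => by ring
      _ = (σD c k n : ℂ) * Complex.I * zD c k w ν n := by rw [σD]; push_cast; ring
  have hsumσ : Summable fun n => rmode (k n) ((σD c k n : ℂ) * Complex.I * zD c k w ν n) y :=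
    (summable_sum fun j _ => (hsum1 j).mul_left (c j)).congr h2
  rw [h1]
  simp_rw [h2]
  rw [← tsum_mul_left, ← hsumσ.tsum_sub (hsum2.mul_left ν)]
  unfold hD modeSeries
  refine tsum_congr fun n => ?_
  have h4 : ν * (-(4 * Real.pi ^ 2 * freqNormSq (k n)) * rmode (k n) (zD c k w ν n) y) =
      -rmode (k n) (((ν * lamD k n : ℝ) : ℂ) * zD c k w ν n) y := by
    rw [rmode_ofReal_mul, lamD]; ring
  rw [h4, sub_neg_eq_add, ← rmode_add, ← denD_mul_zD (w := w) (hσ n) ν]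
  congr 1
  rw [denD]; ring

/-- A constant planar field is divergence free. [folklore] -/
theorem isDivFree_const_planar (a : EuclideanSpace ℝ (Fin 2)) :
    IsDivFree (fun _ : UnitAddTorus (Fin 2) => a) := by
  intro y
  rw [divergence]
  refine Finset.sum_eq_zero fun i _ => ?_
  simp [Torus.partialDeriv, Torus.lineDeriv]

end Planar

/-! ## The three-dimensional steady states -/

section ThreeD

variable (c : EuclideanSpace ℝ (Fin 2)) (k : ℕ → Fin 2 → ℤ) (w : ℕ → ℂ)

/-- **The drift states** `U_ν = (c, R_ν) ∘ π`. [folklore] -/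
def UD (ν : ℝ) : UnitAddTorus (Fin 3) → EuclideanSpace ℝ (Fin 3) :=
  twoHalf (fun _ => c) (RD c k w ν)

/-- **The force** `f = (0, 0, h(x₀,x₁))`, independent of `ν` and of time. [folklore] -/
def fD : UnitAddTorus (Fin 3) → EuclideanSpace ℝ (Fin 3) := twoHalf (fun _ => 0) (hD k w)

variable {c k w}

/-- `f` is smooth. [folklore] -/
theorem isSmooth_fD (hw : RapidDecay k w) : IsSmooth (fD k w) :=
  (isSmooth_const (0 : EuclideanSpace ℝ (Fin 2))).twoHalf (isSmooth_hD hw)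

/-- `f` is divergence free. [folklore] -/
theorem isDivFree_fD : IsDivFree (fD k w) :=
  IsDivFree.twoHalf (isDivFree_const_planar 0) (hD k w)

/-- `f` has zero mean. [folklore] -/
theorem hasZeroMean_fD (hk : ∀ n, k n ≠ 0) (hw : RapidDecay k w) : HasZeroMean (fD k w) :=
  Torus.hasZeroMean_twoHalf (integrable_const _) (isSmooth_hD hw).continuous.integrable_unitAddTorus
    (by simp [HasZeroMean]) (hasZeroMean_hD hk hw)

/-- `U_ν` is smooth (`ν > 0`). [folklore] -/
theorem isSmooth_UD {ν : ℝ} (hν : 0 < ν) (hk : ∀ n, k n ≠ 0) (hw : RapidDecay k w) :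
    IsSmooth (UD c k w ν) :=
  (isSmooth_const c).twoHalf (isSmooth_RD hν hk hw)

/-- The `2½`-dimensional Navier–Stokes force of the ansatz `(V, R, φ) = (c, R_ν, 0)` is
`(0, h) ∘ π = f`. [folklore] -/
theorem twoHalfForce_eq_fD {ν : ℝ} (hν : 0 < ν) (hk : ∀ n, k n ≠ 0) (hw : RapidDecay k w)
    (hσ : ∀ n, σD c k n ≠ 0) :
    Torus.twoHalfForce univ ν (fun _ _ => c) (fun _ => RD c k w ν) (fun _ _ => (0 : ℝ)) =
      fun _ => fD k w := by
  funext t x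
  rw [Torus.twoHalfForce_apply]
  simp only [fD, twoHalf]
  congr 1
  refine Prod.ext ?_ ?_
  · show Literature.Analysis.FunctionSpaces.Torus.timeDerivWithin univ
          (fun (_ : ℝ) (_ : UnitAddTorus (Fin 2)) => c) t (planarProj x) +
        Literature.Analysis.FunctionSpaces.Torus.convect (fun _ : UnitAddTorus (Fin 2) => c)
          (fun _ : UnitAddTorus (Fin 2) => c) (planarProj x) -
        ν • laplacian (fun _ : UnitAddTorus (Fin 2) => c) (planarProj x) +
        gradient (fun _ : UnitAddTorus (Fin 2) => (0 : ℝ)) (planarProj x) = 0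
    have h1 : Literature.Analysis.FunctionSpaces.Torus.timeDerivWithin univ
        (fun (_ : ℝ) (_ : UnitAddTorus (Fin 2)) => c) t (planarProj x) = 0 := by
      simp [Literature.Analysis.FunctionSpaces.Torus.timeDerivWithin]
    have h2 : Literature.Analysis.FunctionSpaces.Torus.convect (fun _ : UnitAddTorus (Fin 2) => c)
        (fun _ : UnitAddTorus (Fin 2) => c) (planarProj x) = 0 := by
      have h : liftAt (fun _ : UnitAddTorus (Fin 2) => c) (planarProj x) = fun _ => c := rfl
      simp only [Literature.Analysis.FunctionSpaces.Torus.convect, Torus.fderiv, h,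
        fderiv_const_apply, zero_apply]
    have h3 : laplacian (fun _ : UnitAddTorus (Fin 2) => c) (planarProj x) = 0 := by
      have h : liftAt (fun _ : UnitAddTorus (Fin 2) => c) (planarProj x) = fun _ => c := rfl
      simp only [Torus.laplacian, h]
      rw [InnerProductSpace.laplacian_const]
      rfl
    have h4 : gradient (fun _ : UnitAddTorus (Fin 2) => (0 : ℝ)) (planarProj x) = 0 :=
      gradient_fun_const (0 : EuclideanSpace ℝ (Fin 2)) (0 : ℝ)
    rw [h1, h2, h3, h4, smul_zero]
    simp
  · show Literature.Analysis.FunctionSpaces.Torus.timeDerivWithin univ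
          (fun (_ : ℝ) => RD c k w ν) t (planarProj x) +
        ⟪c, gradient (RD c k w ν) (planarProj x)⟫_ℝ - ν * laplacian (RD c k w ν) (planarProj x) =
        hD k w (planarProj x)
    have h1 : Literature.Analysis.FunctionSpaces.Torus.timeDerivWithin univ
        (fun (_ : ℝ) => RD c k w ν) t (planarProj x) = 0 := by
      simp [Literature.Analysis.FunctionSpaces.Torus.timeDerivWithin]
    rw [h1, zero_add, drift_diffusion_RD hν hk hw hσ]

/-- **Exact steady solutions**: for every `ν > 0`, `U_ν` (with zero pressure) is a classical
solution of `NS_ν + f` on `ℝ × T³` with the `ν`-independent force `f`.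
[cite: Cheskidov2023, §3 (3.12)–(3.13)] -/
theorem isClassicalNSSolutionOn_UD {ν : ℝ} (hν : 0 < ν) (hk : ∀ n, k n ≠ 0) (hw : RapidDecay k w)
    (hσ : ∀ n, σD c k n ≠ 0) :
    IsClassicalNSSolutionOn univ ν (fun _ => fD k w) (fun _ => UD c k w ν)
      (fun _ => (fun _ : UnitAddTorus (Fin 2) => (0 : ℝ)) ∘ planarProj) := by
  have h := Torus.isClassicalNSSolutionOn_twoHalf uniqueDiffOn_univ ν (V := fun _ _ => c)
    (R := fun _ => RD c k w ν) (φ := fun _ _ => (0 : ℝ))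
    (isSmoothSpaceTimeOn_const (isSmooth_const c) _)
    (isSmoothSpaceTimeOn_const (isSmooth_RD hν hk hw) _)
    (isSmoothSpaceTimeOn_const (isSmooth_const (0 : ℝ)) _) (fun _ _ => isDivFree_const_planar c)
  rw [twoHalfForce_eq_fD hν hk hw hσ] at h
  exact h

/-- **Bounded energy, uniformly in `ν`**, under `A = ∑_n |w_n|/|σ_n| < ∞`:
`‖U_ν(x)‖² = |c|² + R_ν(πx)² ≤ |c|² + A²`. [folklore] -/
theorem norm_sq_UD_le (hσ : ∀ n, σD c k n ≠ 0) (hA : Summable fun n => ‖w n‖ / |σD c k n|)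
    (ν : ℝ) (x : UnitAddTorus (Fin 3)) :
    ‖UD c k w ν x‖ ^ 2 ≤ ‖c‖ ^ 2 + (∑' n, ‖w n‖ / |σD c k n|) ^ 2 := by
  rw [UD, norm_sq_twoHalf]
  have h := abs_RD_le hσ hA ν (planarProj x)
  have h' : RD c k w ν (planarProj x) ^ 2 ≤ (∑' n, ‖w n‖ / |σD c k n|) ^ 2 := by
    rw [← sq_abs]; exact pow_le_pow_left₀ (abs_nonneg _) h 2
  linarith

/-- `∫ ‖U_ν‖² ≤ |c|² + A²` for every `ν > 0`. [folklore] -/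
theorem integral_norm_sq_UD_le {ν : ℝ} (hν : 0 < ν) (hk : ∀ n, k n ≠ 0) (hw : RapidDecay k w)
    (hσ : ∀ n, σD c k n ≠ 0) (hA : Summable fun n => ‖w n‖ / |σD c k n|) :
    ∫ x, ‖UD c k w ν x‖ ^ 2 ≤ ‖c‖ ^ 2 + (∑' n, ‖w n‖ / |σD c k n|) ^ 2 := by
  have hc : Continuous (UD c k w ν) := (isSmooth_UD hν hk hw).continuous
  calc ∫ x, ‖UD c k w ν x‖ ^ 2
      ≤ ∫ _ : UnitAddTorus (Fin 3), (‖c‖ ^ 2 + (∑' n, ‖w n‖ / |σD c k n|) ^ 2) :=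
        integral_mono (hc.norm.pow 2).integrable_unitAddTorus (integrable_const _)
          fun x => norm_sq_UD_le hσ hA ν x
    _ = ‖c‖ ^ 2 + (∑' n, ‖w n‖ / |σD c k n|) ^ 2 := by simp

/-- **Dissipation split**: `‖∇U_ν‖₂² = ‖∇R_ν‖²_{L²}` (the drift is constant).
[cite: Cheskidov2023, §6 p. 19] -/
theorem toReal_eGradNormSq_UD {ν : ℝ} (hν : 0 < ν) (hk : ∀ n, k n ≠ 0) (hw : RapidDecay k w) :
    (eGradNormSq (UD c k w ν)).toReal = Torus.scalarGradNormSq (RD c k w ν) := by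
  have h0 : gradNormSq (fun _ : UnitAddTorus (Fin 2) => c) = 0 := by
    simp [gradNormSq, Torus.partialDeriv, Torus.lineDeriv]
  rw [UD, Torus.toReal_eGradNormSq_twoHalf (isSmooth_const c) (isSmooth_RD hν hk hw), h0, zero_add]

end ThreeD

end Summit.AnomalousDissipation.AnomalousDissipation.Theorems

end
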